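import Literature.MathematicalPhysics.QuantumManyBody.BoseGasThermodynamicLimitRuelle
import HarnessLib

/-!
# Padding cells in a slab of a Dirichlet box

Topic `Literature/MathematicalPhysics/QuantumManyBody`: elementary geometry over the vocabulary of
`BoseGasThermodynamicLimitRuelle.lean` (the cells `subBox ℓ p d` = the open cube `(0,ℓ)³`
translated to the lattice site `d ∈ ℕ³` of pitch `p`, Ruelle's merging of Dirichlet states with
`R`-separated supports, `infEnergy_biUnion_le`). Content (all proved, no definitions,
`[folklore]` / Ruelle 1969 §3.5.11):

* `measurableSet_subBox` — cells are measurable;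
* `subBox_one_subset_box_of_le`, `lt_dist_box_subBox_of_le` — a unit cell `subBox 1 p d` with
  `p d_k + 1 ≤ L''` lies in `Λ_{L''}`, and if `p d_0 ≥ L' + R` it is `R`-separated (sup over the
  first coordinate) from the box `Λ_{L'}`;
* `exists_slab_sites` — `m ≤ A·B·B` pairwise distinct lattice sites with first digit in
  `[a₀, a₀ + A)` and the other two in `[0, B)` (mixed-radix digits);
* `one_add_two_div_mul_le_of_cube` — `(1 + 7/M)L³ ≤ L''³`, `M ≥ 13` force `(1 + 2/M)L ≤ L''`
  (since `(1 + 2/M)³ ≤ 1 + 7/M`);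
* `slab_capacity` — the counting inequality `7ρL³/M + 3 ≤ A·B·B` for `A ≥ L/(Mp) - 2`,
  `B ≥ (L-1)/p`, `L ≥ 4Mp`, `80ρp³ ≤ 1`;
* `exists_slab_cells` — **room for padding**: in the slab `{L' + R ≤ x₀} ∩ Λ_{L''}` of width
  `L'' - L' ≥ L/M`, with `L ≥ 4M(1+R)` and `80ρ(1+R)³ ≤ 1`, there are `m ≤ 7ρL³/M + 3` unit cells
  `subBox 1 (1+R) (d j)` at distinct sites, inside `Λ_{L''}` and beyond `x₀ = L' + R`.

This is the geometric half of the "padded cut-off state" construction (a Dirichlet trial state at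
the SAME density as a given torus state: the cut-off state in `Λ_{L(1+1/M)}` merged with
`≈ 7N/M` one-particle states in separated unit cells, cf. Ruelle's subadditivity argument), used by
the route `BECThomsonPrinciple` of `AtomisticToContinuum/BoseEinsteinCondensation`. Deliberately
NOT here: anything about wave functions (the merge itself is `SupportedState.merge`).

## References

* [Ruelle1969] D. Ruelle, *Statistical Mechanics: Rigorous Results* (1969), §3.5.11 — Dirichlet
  states in separated cells, subadditivity.
-/

noncomputable section

namespace Literature.MathematicalPhysics.QuantumManyBody.BoseGas

open _root_.MeasureTheory
open scoped ENNReal NNReal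

/-- Cells `subBox ℓ p d` are measurable (translates of the open box). [folklore] -/
theorem measurableSet_subBox (ℓ p : ℝ) (d : Fin 3 → ℕ) : MeasurableSet (subBox ℓ p d) :=
  (measurableSet_box ℓ).preimage (measurable_id.sub_const _)

/-- A unit cell `subBox 1 p d` with `p d_k + 1 ≤ L''` for every axis `k` (`p ≥ 0`) lies in the box
`Λ_{L''}`. [cite: Ruelle1969, §3.5.11] -/
theorem subBox_one_subset_box_of_le {p L'' : ℝ} (hp : 0 ≤ p) {d : Fin 3 → ℕ}
    (h : ∀ k, p * d k + 1 ≤ L'') : subBox 1 p d ⊆ box L'' := by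
  intro x hx k
  rw [mem_subBox] at hx
  have h1 := (hx k).1
  have h2 := (hx k).2
  have h0 : (0 : ℝ) ≤ p * d k := mul_nonneg hp (Nat.cast_nonneg _)
  exact ⟨by linarith, by linarith [h k]⟩

/-- A cell of the slab `{L' + R ≤ x₀}` is `R`-separated from the box `Λ_{L'}` (first coordinate).
[cite: Ruelle1969, §3.5.11] -/
theorem lt_dist_box_subBox_of_le {p L' R : ℝ} {d : Fin 3 → ℕ} (h0 : L' + R ≤ p * d 0)
    {x y : Space} (hx : x ∈ box L') (hy : y ∈ subBox 1 p d) : R < dist x y := by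
  rw [mem_subBox] at hy
  have hx0 := (hx 0).2
  have hy0 := (hy 0).1
  refine lt_of_lt_of_le ?_ (PiLp.dist_apply_le x y 0)
  rw [Real.dist_eq, lt_abs]
  right
  linarith

/-- Lattice sites for `m ≤ A·B·B` cells in a slab: first digit in `[a₀, a₀ + A)`, the two other
digits in `[0, B)`, pairwise distinct (mixed-radix digits of `j < A·B·B`). [folklore] -/
theorem exists_slab_sites (a₀ A B m : ℕ) (hm : m ≤ A * B * B) :
    ∃ d : Fin m → Fin 3 → ℕ, Function.Injective d ∧
      ∀ j, a₀ ≤ d j 0 ∧ d j 0 < a₀ + A ∧ d j 1 < B ∧ d j 2 < B := by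
  let f : Fin m → (Fin A × Fin B) × Fin B := fun j =>
    (finProdFinEquiv.symm (finProdFinEquiv.symm (Fin.castLE hm j)).1,
      (finProdFinEquiv.symm (Fin.castLE hm j)).2)
  have hf : Function.Injective f := by
    intro j j' h
    have h1 := congrArg Prod.fst h
    have h2 := congrArg Prod.snd h
    simp only [f] at h1 h2
    have h3 : finProdFinEquiv.symm (Fin.castLE hm j) = finProdFinEquiv.symm (Fin.castLE hm j') :=
      Prod.ext (finProdFinEquiv.symm.injective h1) h2
    exact Fin.castLE_injective hm (finProdFinEquiv.symm.injective h3)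
  refine ⟨fun j => ![a₀ + (f j).1.1, (f j).1.2, (f j).2], fun j j' h => hf ?_, fun j => ?_⟩
  · have h0 := congrFun h 0
    have h1 := congrFun h 1
    have h2 := congrFun h 2
    simp only [Matrix.cons_val_zero, Matrix.cons_val_one, Matrix.cons_val_two, Matrix.tail_cons,
      Matrix.head_cons, add_right_inj] at h0 h1 h2
    exact Prod.ext (Prod.ext (Fin.ext h0) (Fin.ext h1)) (Fin.ext h2)
  · simp only [Matrix.cons_val_zero, Matrix.cons_val_one, Matrix.cons_val_two, Matrix.tail_cons,
      Matrix.head_cons]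
    exact ⟨Nat.le_add_right _ _, Nat.add_lt_add_left (f j).1.1.isLt _, (f j).1.2.isLt, (f j).2.isLt⟩

/-- `(1 + 7/M) L³ ≤ L''³` with `M ≥ 13` forces `(1 + 2/M) L ≤ L''`, since `(1 + 2/M)³ ≤ 1 + 7/M`.
[folklore] -/
theorem one_add_two_div_mul_le_of_cube {M L L'' : ℝ} (hM : 13 ≤ M) (hL : 0 ≤ L) (hL'' : 0 ≤ L'')
    (h : (1 + 7 / M) * L ^ 3 ≤ L'' ^ 3) : (1 + 2 / M) * L ≤ L'' := by
  have hM0 : 0 < M := by linarith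
  obtain ⟨t, ht0, ht1, h7, h2⟩ : ∃ t : ℝ, 0 < t ∧ t ≤ 1 / 13 ∧ 7 / M = 7 * t ∧ 2 / M = 2 * t :=
    ⟨1 / M, by positivity, one_div_le_one_div_of_le (by norm_num) hM, by ring, by ring⟩
  rw [h7] at h
  rw [h2]
  have h12 : 12 * t + 8 * t ^ 2 ≤ 1 := by nlinarith [mul_le_mul ht1 ht1 ht0.le (by norm_num)]
  have hcube : (1 + 2 * t) ^ 3 ≤ 1 + 7 * t := by
    nlinarith [mul_le_mul_of_nonneg_left h12 ht0.le]
  refine le_of_pow_le_pow_left₀ three_ne_zero hL'' ?_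
  calc ((1 + 2 * t) * L) ^ 3 = (1 + 2 * t) ^ 3 * L ^ 3 := by ring
    _ ≤ (1 + 7 * t) * L ^ 3 := by gcongr
    _ ≤ L'' ^ 3 := h

/-- **Capacity of the slab.** With pitch `p ≥ 1`, `M ≥ 2`, `L ≥ 4Mp` and `ρ (80 p³) ≤ 1`: if the
numbers of admissible digits satisfy `A ≥ L/(Mp) - 2` and `B ≥ (L-1)/p`, then
`7ρL³/M + 3 ≤ A·B·B`. [folklore] -/
theorem slab_capacity {p M L ρ A B : ℝ} (hp : 1 ≤ p) (hM : 2 ≤ M) (hL : 4 * M * p ≤ L)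
    (hρ : 0 ≤ ρ) (hρp : ρ * (80 * p ^ 3) ≤ 1) (hA : L / (M * p) - 2 ≤ A) (hB : (L - 1) / p ≤ B) :
    7 * (ρ * L ^ 3) / M + 3 ≤ A * B * B := by
  have hp0 : 0 < p := by linarith
  have hM0 : 0 < M := by linarith
  obtain ⟨y, hy4, hLy⟩ : ∃ y : ℝ, 4 ≤ y ∧ L = M * p * y :=
    ⟨L / (M * p), by rw [le_div_iff₀ (by positivity)]; linarith, by field_simp⟩
  have hy0 : 0 < y := by linarith
  have hA' : y / 2 ≤ A := by
    have h1 : L / (M * p) = y := by rw [hLy]; field_simp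
    rw [h1] at hA
    linarith
  have hB' : M * y / 2 ≤ B := by
    have h1 : (L - 1) / p = M * y - 1 / p := by rw [hLy]; field_simp
    have h2 : 1 / p ≤ 1 := by rw [div_le_one hp0]; exact hp
    have h3 : 2 ≤ M * y := by nlinarith
    rw [h1] at hB
    linarith
  have hA0 : 0 ≤ A := by linarith
  have hB0 : 0 ≤ B := by nlinarith
  have hABB : y / 2 * (M * y / 2) * (M * y / 2) ≤ A * B * B :=
    mul_le_mul (mul_le_mul hA' hB' (by positivity) hA0) hB' (by positivity) (mul_nonneg hA0 hB0)
  have hM2 : 4 ≤ M ^ 2 := by nlinarith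
  have hy3 : 64 ≤ y ^ 3 := by nlinarith [mul_le_mul hy4 hy4 (by norm_num) hy0.le]
  have hQ : 80 ≤ M ^ 2 * y ^ 3 := by nlinarith [mul_le_mul hM2 hy3 (by norm_num) (by positivity)]
  have hρ' : ρ * p ^ 3 ≤ 1 / 80 := by
    rw [le_div_iff₀ (by norm_num : (0 : ℝ) < 80)]
    linarith
  calc 7 * (ρ * L ^ 3) / M + 3 = 7 * (ρ * p ^ 3) * (M ^ 2 * y ^ 3) + 3 := by
        rw [hLy]; field_simp
    _ ≤ 7 * (1 / 80) * (M ^ 2 * y ^ 3) + 3 := by gcongr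
    _ ≤ M ^ 2 * y ^ 3 / 8 := by linarith
    _ = y / 2 * (M * y / 2) * (M * y / 2) := by ring
    _ ≤ A * B * B := hABB

/-- **Room for the padding cells.** In the slab `{L' + R ≤ x₀} ∩ Λ_{L''}` of width
`L'' - L' ≥ L/M`, with `L ≥ 4M(1+R)` and `80ρ(1+R)³ ≤ 1`, there are `m ≤ 7ρL³/M + 3` unit cells
`subBox 1 (1+R) (d j)` at pairwise distinct lattice sites, each inside `Λ_{L''}`
(`(1+R) d_k + 1 ≤ L''`) and beyond `x₀ = L' + R` (`(1+R) d_0 ≥ L' + R`): the sites of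
`exists_slab_sites` with `a₀ = ⌈(L'+R)/(1+R)⌉`, `B = ⌊(L''-1)/(1+R)⌋ + 1`,
`A = ⌊(L''-1)/(1+R) + 1 - a₀⌋`, counted by `slab_capacity`. [cite: Ruelle1969, §3.5.11] -/
theorem exists_slab_cells {R M L L' L'' ρ : ℝ} {m : ℕ} (hR : 0 < R) (hM : 2 ≤ M)
    (hL4 : 4 * M * (1 + R) ≤ L) (hLL' : L ≤ L') (hgap : L / M ≤ L'' - L') (hρ : 0 ≤ ρ)
    (hρbar : ρ * (80 * (1 + R) ^ 3) ≤ 1) (hm : (m : ℝ) ≤ 7 * (ρ * L ^ 3) / M + 3) :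
    ∃ d : Fin m → Fin 3 → ℕ, Function.Injective d ∧
      (∀ j k, (1 + R) * d j k + 1 ≤ L'') ∧ ∀ j, L' + R ≤ (1 + R) * d j 0 := by
  have hp0 : (0 : ℝ) < 1 + R := by linarith
  have hM0 : 0 < M := by linarith
  have hLM : 4 * (1 + R) ≤ L / M := by rw [le_div_iff₀ hM0]; linarith
  have hL0 : 0 < L := by nlinarith
  set s : ℝ := (L'' - 1) / (1 + R) with hsdef
  set a₀ : ℕ := ⌈(L' + R) / (1 + R)⌉₊ with ha₀def
  set A : ℕ := ⌊s + 1 - a₀⌋₊ with hAdef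
  set B : ℕ := ⌊s⌋₊ + 1 with hBdef
  have hs0 : 0 ≤ s := div_nonneg (by nlinarith) hp0.le
  have ha₀ : (L' + R) / (1 + R) ≤ a₀ := Nat.le_ceil _
  have ha₀' : (a₀ : ℝ) < (L' + R) / (1 + R) + 1 :=
    Nat.ceil_lt_add_one (div_nonneg (by linarith) hp0.le)
  have hsa : L / (M * (1 + R)) - 2 < s - a₀ := by
    have h1 : s - (L' + R) / (1 + R) = (L'' - L' - (1 + R)) / (1 + R) := by
      rw [hsdef]; field_simp; ring
    have h2 : L / (M * (1 + R)) - 2 = (L / M - (1 + R)) / (1 + R) - 1 := by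
      field_simp; ring
    rw [h2]
    have h3 : (L / M - (1 + R)) / (1 + R) ≤ (L'' - L' - (1 + R)) / (1 + R) :=
      div_le_div_of_nonneg_right (by linarith) hp0.le
    linarith
  have hA0r : 0 ≤ s + 1 - a₀ := by
    have : (4 : ℝ) ≤ L / (M * (1 + R)) := by
      rw [le_div_iff₀ (by positivity)]; linarith
    linarith
  have hA : (A : ℝ) ≤ s + 1 - a₀ := Nat.floor_le hA0r
  have hA' : s + 1 - a₀ < A + 1 := Nat.lt_floor_add_one _
  have hB' : ((⌊s⌋₊ : ℕ) : ℝ) ≤ s := Nat.floor_le hs0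
  have hmcap : m ≤ A * B * B := by
    have h : (m : ℝ) ≤ A * B * B := by
      refine hm.trans (slab_capacity (by linarith) hM hL4 hρ hρbar (by linarith) ?_)
      rw [hBdef]; push_cast
      have : (L - 1) / (1 + R) ≤ s := div_le_div_of_nonneg_right (by linarith) hp0.le
      linarith [Nat.lt_floor_add_one s]
    exact_mod_cast h
  obtain ⟨d, hdinj, hd⟩ := exists_slab_sites a₀ A B m hmcap
  have hdig : ∀ j, ((d j 0 : ℕ) : ℝ) ≤ s ∧ ((d j 1 : ℕ) : ℝ) ≤ s ∧ ((d j 2 : ℕ) : ℝ) ≤ s := by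
    intro j
    obtain ⟨-, hjA, hj1, hj2⟩ := hd j
    have h0 : ((d j 0 : ℕ) : ℝ) + 1 ≤ a₀ + A := by exact_mod_cast hjA
    have h1 : ((d j 1 : ℕ) : ℝ) + 1 ≤ (⌊s⌋₊ : ℕ) + 1 := by exact_mod_cast hj1
    have h2 : ((d j 2 : ℕ) : ℝ) + 1 ≤ (⌊s⌋₊ : ℕ) + 1 := by exact_mod_cast hj2
    exact ⟨by linarith, by linarith, by linarith⟩
  have hcell : ∀ j k, ((d j k : ℕ) : ℝ) ≤ s → (1 + R) * d j k + 1 ≤ L'' := by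
    intro j k hk
    have h1 : (1 + R) * d j k ≤ (1 + R) * s := mul_le_mul_of_nonneg_left hk hp0.le
    have h2 : (1 + R) * s = L'' - 1 := by rw [hsdef]; field_simp
    linarith
  refine ⟨d, hdinj, fun j k => ?_, fun j => ?_⟩
  · fin_cases k
    · exact hcell j 0 (hdig j).1
    · exact hcell j 1 (hdig j).2.1
    · exact hcell j 2 (hdig j).2.2
  · have h1 : (a₀ : ℝ) ≤ d j 0 := by exact_mod_cast (hd j).1
    have h2 := (div_le_iff₀ hp0).1 (ha₀.trans h1)
    linarith [mul_comm (1 + R) (d j 0 : ℝ)]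

end Literature.MathematicalPhysics.QuantumManyBody.BoseGas

end
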